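import Mathlib.MeasureTheory.Measure.Lebesgue.VolumeOfBalls
import Mathlib.MeasureTheory.Measure.Haar.InnerProductSpace
import HarnessLib

/-!
# Lattice points of `ℤ²` in a disc: upper count `#T ≤ π (ρ + 2)²`

HONEST FRAMING. Part of the venture `Summits/Ventures/Crystal3D` (cell `crystal3d-full`), helper
`--supports` the crux `NoReconstructionGain` (stmt-Ventures-19144, route
`route-Ventures-StickyWulffConstant`).  Elementary geometry of numbers, the UPPER companion of
`StickySpheres/SquareDiscCount.lean` (`π(ρ − 2)² ≤ #T`); together they bound the number of sites
of a square `(100)` layer in an annulus by `O(ρ)` (rim count of the cube-facet adhesion rung).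

**Theorem** (`square_disc_count_upper`). If every `(i, j) ∈ T ⊆ ℤ²` lies within distance `ρ`
of `(c₀, c₁)` (`ρ ≥ 0`), then `#T ≤ π (ρ + 2)²`: the unit boxes `(i, j) + [0,1)²` are pairwise
disjoint and lie in the disc of radius `ρ + 2`.

WHAT THIS IS NOT: not the Gauss circle problem; crude `O(ρ)` error.
-/

noncomputable section

namespace Summit.Ventures.Crystal3D.Theorems

open MeasureTheory Set Finset

/-- **Square-lattice disc count, upper bound.** If every `(i, j) ∈ T` satisfies
`(i − c₀)² + (j − c₁)² ≤ ρ²` with `0 ≤ ρ`, then `#T ≤ π (ρ + 2)²`. -/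
theorem square_disc_count_upper (c₀ c₁ ρ : ℝ) (hρ : 0 ≤ ρ) (T : Finset (ℤ × ℤ))
    (hT : ∀ p ∈ T, ((p.1 : ℝ) - c₀) ^ 2 + ((p.2 : ℝ) - c₁) ^ 2 ≤ ρ ^ 2) :
    (T.card : ℝ) ≤ Real.pi * (ρ + 2) ^ 2 := by
  classical
  -- boxes
  set Box : ℤ × ℤ → Set (Fin 2 → ℝ) := fun p =>
    Set.pi Set.univ fun m : Fin 2 =>
      Ico ((![(p.1 : ℝ), (p.2 : ℝ)] : Fin 2 → ℝ) m) ((![(p.1 : ℝ), (p.2 : ℝ)] : Fin 2 → ℝ) m + 1)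
    with hBox
  have hBoxvol : ∀ p, volume (Box p) = 1 := by
    intro p
    rw [hBox]
    simp only
    rw [Real.volume_pi_Ico]
    simp
  have hBoxmeas : ∀ p, MeasurableSet (Box p) := fun p =>
    MeasurableSet.univ_pi fun _ => measurableSet_Ico
  have hmemBox : ∀ (p : ℤ × ℤ) (y : Fin 2 → ℝ), y ∈ Box p ↔
      ((p.1 : ℝ) ≤ y 0 ∧ y 0 < p.1 + 1) ∧ ((p.2 : ℝ) ≤ y 1 ∧ y 1 < p.2 + 1) := by
    intro p y
    rw [hBox, Set.mem_univ_pi, Fin.forall_fin_two]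
    simp
  -- boxes are pairwise disjoint
  have hdisj : (↑T : Set (ℤ × ℤ)).PairwiseDisjoint Box := by
    intro p _ p' _ hne
    rw [Function.onFun, Set.disjoint_left]
    intro y hy hy'
    rw [hmemBox] at hy hy'
    apply hne
    have h1 : p.1 = p'.1 := by
      have a1 : (p.1 : ℝ) < p'.1 + 1 := by linarith [hy.1.1, hy'.1.2]
      have a2 : (p'.1 : ℝ) < p.1 + 1 := by linarith [hy'.1.1, hy.1.2]
      have b1 : p.1 < p'.1 + 1 := by exact_mod_cast a1
      have b2 : p'.1 < p.1 + 1 := by exact_mod_cast a2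
      omega
    have h2 : p.2 = p'.2 := by
      have a1 : (p.2 : ℝ) < p'.2 + 1 := by linarith [hy.2.1, hy'.2.2]
      have a2 : (p'.2 : ℝ) < p.2 + 1 := by linarith [hy'.2.1, hy.2.2]
      have b1 : p.2 < p'.2 + 1 := by exact_mod_cast a1
      have b2 : p'.2 < p.2 + 1 := by exact_mod_cast a2
      omega
    exact Prod.ext h1 h2
  set U : Set (Fin 2 → ℝ) := ⋃ p ∈ T, Box p with hU
  have hUvol : volume U = (T.card : ENNReal) := by
    rw [hU, measure_biUnion_finset hdisj fun p _ => hBoxmeas p]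
    simp [hBoxvol]
  -- the big disc
  set c : Fin 2 → ℝ := ![c₀, c₁] with hc
  set D : Set (Fin 2 → ℝ) :=
    (WithLp.toLp 2 : (Fin 2 → ℝ) → EuclideanSpace ℝ (Fin 2)) ⁻¹'
      Metric.ball (WithLp.toLp 2 c) (ρ + 2) with hD
  have hDvol : volume D = ENNReal.ofReal (ρ + 2) ^ 2 * ENNReal.ofReal Real.pi := by
    rw [hD, (PiLp.volume_preserving_toLp (Fin 2)).measure_preimage
      measurableSet_ball.nullMeasurableSet, EuclideanSpace.volume_ball_fin_two]
  have hdist : ∀ a b : Fin 2 → ℝ,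
      dist (WithLp.toLp 2 a : EuclideanSpace ℝ (Fin 2)) (WithLp.toLp 2 b) =
        Real.sqrt ((a 0 - b 0) ^ 2 + (a 1 - b 1) ^ 2) := by
    intro a b
    rw [EuclideanSpace.dist_eq, Fin.sum_univ_two]
    simp only [Real.dist_eq, sq_abs]
  have hsub : U ⊆ D := by
    intro y hy
    rw [hU, Set.mem_iUnion₂] at hy
    obtain ⟨p, hp, hyp⟩ := hy
    rw [hmemBox] at hyp
    rw [hD, Set.mem_preimage, Metric.mem_ball]
    have hcorner := hT p hp
    set P1 : EuclideanSpace ℝ (Fin 2) := WithLp.toLp 2 y with hP1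
    set P2 : EuclideanSpace ℝ (Fin 2) := WithLp.toLp 2 ![(p.1 : ℝ), (p.2 : ℝ)] with hP2
    set P3 : EuclideanSpace ℝ (Fin 2) := WithLp.toLp 2 c with hP3
    have h12 : dist P1 P2 < 2 := by
      rw [hP1, hP2, hdist]
      simp only [Matrix.cons_val_zero, Matrix.cons_val_one]
      have hlt : (y 0 - (p.1 : ℝ)) ^ 2 + (y 1 - (p.2 : ℝ)) ^ 2 < 4 := by
        nlinarith [hyp.1.1, hyp.1.2, hyp.2.1, hyp.2.2]
      calc Real.sqrt _ < Real.sqrt 4 := Real.sqrt_lt_sqrt (by positivity) hlt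
        _ = 2 := by rw [show (4 : ℝ) = 2 ^ 2 by norm_num, Real.sqrt_sq (by norm_num)]
    have h23 : dist P2 P3 ≤ ρ := by
      rw [hP2, hP3, hdist]
      simp only [Matrix.cons_val_zero, Matrix.cons_val_one, hc]
      calc Real.sqrt _ ≤ Real.sqrt (ρ ^ 2) := Real.sqrt_le_sqrt hcorner
        _ = ρ := Real.sqrt_sq hρ
    linarith [dist_triangle P1 P2 P3]
  have hle : volume U ≤ volume D := measure_mono hsub
  rw [hUvol, hDvol] at hle
  have hρ2 : 0 ≤ ρ + 2 := by linarith
  have hle' : ENNReal.ofReal (T.card : ℝ) ≤ ENNReal.ofReal ((ρ + 2) ^ 2 * Real.pi) := by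
    rw [ENNReal.ofReal_natCast, ENNReal.ofReal_mul (sq_nonneg _), ENNReal.ofReal_pow hρ2]
    exact hle
  have hreal := (ENNReal.ofReal_le_ofReal_iff (by positivity)).1 hle'
  linarith

end Summit.Ventures.Crystal3D.Theorems

end
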